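import Summits.ResolutionOfSingularities.KangarooAtlas.MizutaniRationalField
import Summits.ResolutionOfSingularities.KangarooAtlas.MizutaniDiffDuality
import Mathlib.RingTheory.MvPolynomial.Homogeneous
import Mathlib.Algebra.Polynomial.Basic
import HarnessLib

/-!
# Mizutani's conjecture `m(e) = 2p^e − 1` — the point of `ℙ^{2q−1}` realising Mizutani's scheme `H_e`

Cell topic `Summits/ResolutionOfSingularities/KangarooAtlas` (pub-rosobs); namespace
`Summit.ResolutionOfSingularities.KangarooAtlas.Mizutani`.  Part of the Lean transcription of the
in-house note MIZUTANI-PROOF-g59 (AI-written, AI-audited; *AI review is weaker than expert review*; not a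
resolution theorem).  ATTAINMENT, step 2 (note §10; Mizutani 1973 Remark 2.10 / Example 2.1): over the rational
function field `k = F(u_0, u_1)` (`MizutaniRationalField`, `F` with `c^p = c`), `q = p^e`, take the `2q` monomials
`c_i = u_0^{ε} u_1^{j}` (`ε ∈ {0,1}`, `j < q`; indices `i ∈ Fin (N+1)`, `N + 1 = 2q`, decoded by `attIdx`) and the
homogeneous ideal

  `attP = ker( k[X_0, …, X_N] → k[T], X_i ↦ c_i · T, scalars through the Frobenius F^e )`,

i.e. the point `(c_i^{1/q})_i` of `ℙ^N` over the tower `k^{1/q}` written inside `k` (the twist by `F^e` replaces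
`q`-th roots).  Proved here:

* `isPoint_attP` — `attP` is a homogeneous prime not containing the irrelevant ideal (`IsPoint`);
* `addForm_mem_attP_iff` — an additive form of level `e + m` lies in `attP` iff `Σ_i g_i c_i^{p^m} = 0`;
* `mem_invForms_attP_iff` — **`a ∈ (L_B)_{e+m} ⟺ Σ_i a_i ⊗ c_i^{p^m} ∈ J^{p^{e+m}}`** in `k ⊗_{k^{p^{e+m}}} k`
  (Oda's definition of the invariant forms, read through encloser-2's duality `mem_ideal_pow_iff_forall_dPair`);
* `Omega_attBeta` — in the tower coordinates of `k ⊃ k^{p^{e+m}}` (`isRootTower_ratField`), the element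
  `Σ_i a_i ⊗ c_i^{p^m}` has left coordinates `Σ_i a_i · (u + X)^{p^m W_i}`.

References: [Mizutani1973HironakaGroupSchemes] Remark 2.10 (the schemes `H_e`), Example 2.1; in-house note §10;
[Oda1983HironakaGroupSchemeII] §2 (p. 1168), Thm. 3.1.
-/

open MvPolynomial TensorProduct Literature.AlgebraicGeometry.Resolution
  Literature.AlgebraicGeometry.Resolution.HironakaScheme

namespace Summit.ResolutionOfSingularities.KangarooAtlas.Mizutani

universe u

section Point

variable (F : Type u) [Field F] (p e : ℕ) [hp : Fact p.Prime] [CharP F p]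

/-- `N = 2q − 1`, so that the ambient projective space is `ℙ^N` with `N + 1 = 2q` homogeneous coordinates.
[cite: Mizutani1973HironakaGroupSchemes, Remark 2.10 (dim H_e = 2p^e − 1 inside a 2p^e-dimensional vector group)] -/
def attN : ℕ := 2 * p ^ e - 1

/-- `N + 1 = 2q`. [folklore] -/
theorem attN_succ : attN p e + 1 = 2 * p ^ e := by
  unfold attN
  have : 1 ≤ p ^ e := Nat.one_le_pow _ _ hp.out.pos
  omega

/-- Decoding of an index `i < 2q` as `(ε, j) ∈ {0,1} × [0, q)`. [folklore] -/
def attIdx : Fin (attN p e + 1) ≃ Fin 2 × Fin (p ^ e) :=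
  (finCongr (attN_succ p e)).trans finProdFinEquiv.symm

/-- The exponent vector `W_i = (ε_i, j_i)` of the `i`-th monomial `c_i = u_0^{ε_i} u_1^{j_i}`. [folklore] -/
noncomputable def attW (i : Fin (attN p e + 1)) : Fin 2 →₀ ℕ :=
  Finsupp.equivFunOnFinite.symm ![((attIdx p e i).1 : ℕ), ((attIdx p e i).2 : ℕ)]

/-- `W_i 0 = ε_i`. [folklore] -/
@[simp] theorem attW_zero (i : Fin (attN p e + 1)) : attW p e i 0 = ((attIdx p e i).1 : ℕ) := by
  simp [attW]

/-- `W_i 1 = j_i`. [folklore] -/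
@[simp] theorem attW_one (i : Fin (attN p e + 1)) : attW p e i 1 = ((attIdx p e i).2 : ℕ) := by
  simp [attW]

/-- `i ↦ W_i` is injective. [folklore] -/
theorem attW_injective : Function.Injective (attW p e) := by
  intro i j h
  have h0 := congrArg (fun W : Fin 2 →₀ ℕ => W 0) h
  have h1 := congrArg (fun W : Fin 2 →₀ ℕ => W 1) h
  simp only [attW_zero, attW_one] at h0 h1
  exact (attIdx p e).injective (Prod.ext (Fin.ext h0) (Fin.ext h1))

/-- The monomials `c_i = u^{W_i} = u_0^{ε_i} u_1^{j_i} ∈ k = F(u_0, u_1)` — the right support of Mizutani's relation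
`t_0 t_1^{q−1}` (note §10). [cite: Mizutani1973HironakaGroupSchemes, Remark 2.10 (in-house proof §10: H = H_R(ω))] -/
noncomputable def attC (i : Fin (attN p e + 1)) : RatField F 2 := ∏ l, ratGen F 2 l ^ attW p e i l

/-- The images `ξ_i = c_i · T` of the homogeneous coordinates. [cite: Oda1983HironakaGroupSchemeII, Thm. 3.1 (p. 1173: the point attached to φ : L_0 → E)] -/
noncomputable def attXi (i : Fin (attN p e + 1)) : Polynomial (RatField F 2) :=
  Polynomial.C (attC F p e i) * Polynomial.X

/-- The defining homomorphism `k[X_0..X_N] → k[T]`, `X_i ↦ c_i T`, scalars through `F^e : k → k`.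
[cite: Oda1983HironakaGroupSchemeII, §2 (p. 1168: the twist F^e identifying F^{-e}(k) ⊗ L_0 with L_e)] -/
noncomputable def attPsi : MvPolynomial (Fin (attN p e + 1)) (RatField F 2) →+* Polynomial (RatField F 2) :=
  eval₂Hom (Polynomial.C.comp (iterateFrobenius (RatField F 2) p e : RatField F 2 →+* RatField F 2)) (attXi F p e)

/-- The same map with `T = 1`: `k[X] → k`, `X_i ↦ c_i`, scalars through `F^e`. [folklore] -/
noncomputable def attChi : MvPolynomial (Fin (attN p e + 1)) (RatField F 2) →+* RatField F 2 :=
  eval₂Hom (iterateFrobenius (RatField F 2) p e : RatField F 2 →+* RatField F 2) (attC F p e)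

/-- **The point**: the homogeneous prime `attP = ker(X_i ↦ c_i T)` of `k[X_0, …, X_N]`.
[cite: Mizutani1973HironakaGroupSchemes, Remark 2.10 (the schemes H_e; in-house proof §10)] -/
noncomputable def attP : Ideal (MvPolynomial (Fin (attN p e + 1)) (RatField F 2)) := RingHom.ker (attPsi F p e)

variable {F p e}

/-- `attPsi` on a monomial: `a X^m ↦ (F^e a · c^m) T^{|m|}`. [folklore] -/
theorem attPsi_monomial (m : Fin (attN p e + 1) →₀ ℕ) (a : RatField F 2) :
    attPsi F p e (monomial m a) = Polynomial.monomial m.degree (attChi F p e (monomial m a)) := by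
  unfold attPsi attChi
  rw [eval₂Hom_monomial, eval₂Hom_monomial, RingHom.comp_apply, ← Polynomial.C_mul_X_pow_eq_monomial, map_mul,
    mul_assoc]
  congr 1
  unfold attXi
  rw [Finsupp.degree_apply, Finsupp.prod, Finsupp.prod, map_prod, ← Finset.prod_pow_eq_pow_sum,
    ← Finset.prod_mul_distrib]
  refine Finset.prod_congr rfl fun i _ => ?_
  rw [mul_pow, map_pow]

/-- `attPsi` on a homogeneous polynomial of degree `d` is `attChi(φ) · T^d`. [folklore] -/
theorem attPsi_of_isHomogeneous {φ : MvPolynomial (Fin (attN p e + 1)) (RatField F 2)} {d : ℕ}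
    (hφ : φ.IsHomogeneous d) : attPsi F p e φ = Polynomial.monomial d (attChi F p e φ) := by
  conv_lhs => rw [φ.as_sum]
  conv_rhs => rw [φ.as_sum]
  rw [map_sum, map_sum, map_sum]
  refine Finset.sum_congr rfl fun m hm => ?_
  have hmd : m.degree = d := by
    have h := hφ (mem_support_iff.mp hm)
    rw [Finsupp.degree_eq_weight_one]
    exact h
  rw [attPsi_monomial, hmd]

/-- The `T^d`-coefficient of `attPsi f` is `attChi` of the degree-`d` homogeneous component of `f`. [folklore] -/
theorem coeff_attPsi (f : MvPolynomial (Fin (attN p e + 1)) (RatField F 2)) (d : ℕ) :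
    (attPsi F p e f).coeff d = attChi F p e (homogeneousComponent d f) := by
  classical
  conv_lhs => rw [← sum_homogeneousComponent f, map_sum]
  rw [Polynomial.finsetSum_coeff]
  have hterm : ∀ i ∈ Finset.range (f.totalDegree + 1),
      (attPsi F p e (homogeneousComponent i f)).coeff d =
        if i = d then attChi F p e (homogeneousComponent d f) else 0 := by
    intro i _
    rw [attPsi_of_isHomogeneous (homogeneousComponent_isHomogeneous i f), Polynomial.coeff_monomial]
    by_cases hid : i = d
    · subst hid; simp
    · simp [hid]
  rw [Finset.sum_congr rfl hterm, Finset.sum_ite_eq' (Finset.range (f.totalDegree + 1)) d]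
  split_ifs with hd
  · rfl
  · rw [Finset.mem_range, not_lt] at hd
    rw [homogeneousComponent_eq_zero d f (by omega), map_zero]

/-- **`attP` is homogeneous**: with `f` it contains every homogeneous component of `f`. [cite: Oda1983HironakaGroupSchemeII, §2 (p. 1168: homogeneous prime ideals 𝔭 ≠ S_+)] -/
theorem homogeneousComponent_mem_attP {f : MvPolynomial (Fin (attN p e + 1)) (RatField F 2)}
    (hf : f ∈ attP F p e) (d : ℕ) : homogeneousComponent d f ∈ attP F p e := by
  unfold attP at hf ⊢
  rw [RingHom.mem_ker] at hf ⊢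
  rw [attPsi_of_isHomogeneous (homogeneousComponent_isHomogeneous d f), ← coeff_attPsi, hf,
    Polynomial.coeff_zero, map_zero]

omit [CharP F p] in
/-- `c_i ≠ 0`. [folklore] -/
theorem attC_ne_zero (i : Fin (attN p e + 1)) : attC F p e i ≠ 0 := by
  unfold attC ratGen
  refine Finset.prod_ne_zero_iff.mpr fun l _ => pow_ne_zero _ ?_
  exact IsFractionRing.to_map_ne_zero_of_mem_nonZeroDivisors
    (mem_nonZeroDivisors_of_ne_zero (X_ne_zero l))

/-- **`attP` is a point of `ℙ^N`** in Oda's sense: a homogeneous prime not containing the irrelevant ideal.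
[cite: Oda1983HironakaGroupSchemeII, §2 (p. 1168: "a homogeneous prime ideal 𝔭 of S with 𝔭 ≠ S_+")] -/
theorem isPoint_attP : IsPoint (RatField F 2) (attP F p e) := by
  refine ⟨RingHom.ker_isPrime _, fun f hf d => homogeneousComponent_mem_attP hf d, fun hle => ?_⟩
  have hX : (X 0 : MvPolynomial (Fin (attN p e + 1)) (RatField F 2)) ∈ irrelevant (RatField F 2) (attN p e) := by
    unfold irrelevant; rw [RingHom.mem_ker, constantCoeff_X]
  have h := hle hX
  unfold attP at h
  rw [RingHom.mem_ker] at h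
  unfold attPsi at h
  rw [eval₂Hom_X'] at h
  unfold attXi at h
  rw [mul_eq_zero, Polynomial.C_eq_zero] at h
  rcases h with h | h
  · exact attC_ne_zero 0 h
  · exact Polynomial.X_ne_zero h

/-- `attP ≠ ⊤`. [folklore] -/
theorem attP_ne_top : attP F p e ≠ ⊤ := (isPoint_attP (F := F) (p := p) (e := e)).1.ne_top

/-! ### Additive forms in `attP` -/

/-- `c_i^{p^e · p^m} = F^e (c_i^{p^m})`. [folklore] -/
theorem attC_pow_pow (m : ℕ) (i : Fin (attN p e + 1)) :
    attC F p e i ^ p ^ (e + m) = iterateFrobenius (RatField F 2) p e (attC F p e i ^ p ^ m) := by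
  rw [iterateFrobenius_def, ← pow_mul, ← pow_add, add_comm]

/-- **An additive form of level `e + m` lies in `attP` iff `Σ_i g_i c_i^{p^m} = 0`.**
[cite: Oda1983HironakaGroupSchemeII, Lemma 2.1 (p. 1169: Q = 𝔭 ∩ L)] -/
theorem addForm_mem_attP_iff (m : ℕ) (g : Fin (attN p e + 1) → RatField F 2) :
    addForm (RatField F 2) p (e + m) g ∈ attP F p e ↔ ∑ i, g i * attC F p e i ^ p ^ m = 0 := by
  unfold attP addForm
  rw [RingHom.mem_ker, map_sum]
  have hterm : ∀ i, attPsi F p e (C (g i) * X i ^ p ^ (e + m)) =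
      Polynomial.C (iterateFrobenius (RatField F 2) p e (g i * attC F p e i ^ p ^ m)) *
        Polynomial.X ^ p ^ (e + m) := by
    intro i
    unfold attPsi
    rw [map_mul, map_pow, eval₂Hom_C, eval₂Hom_X', RingHom.comp_apply]
    unfold attXi
    rw [mul_pow, ← map_pow, attC_pow_pow, map_mul, map_mul]
    ring
  rw [Finset.sum_congr rfl fun i _ => hterm i, ← Finset.sum_mul, ← map_sum, ← map_sum, mul_eq_zero,
    Polynomial.C_eq_zero, map_eq_zero_iff _ (iterateFrobenius (RatField F 2) p e).injective]
  constructor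
  · rintro (h | h)
    · exact h
    · exact absurd h (pow_ne_zero _ Polynomial.X_ne_zero)
  · intro h; exact Or.inl h

/-! ### The invariant forms as tensors -/

/-- `β_m(a) = Σ_i a_i ⊗ c_i^{p^m} ∈ k ⊗_{k^{p^{e+m}}} k`. [cite: Mizutani1973HironakaGroupSchemes, Remark 2.10 (in-house proof §10: ω = Σ a_i ⊗ c_i, N(H))] -/
noncomputable def attBeta (m : ℕ) (a : Fin (attN p e + 1) → RatField F 2) :
    RatField F 2 ⊗[frobPow (RatField F 2) p (e + m)] RatField F 2 :=
  ∑ i, a i ⊗ₜ[frobPow (RatField F 2) p (e + m)] (attC F p e i ^ p ^ m)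

/-- **`a ∈ (L_B)_{e+m}(attP) ⟺ β_m(a) ∈ J^{p^{e+m}}`**: Oda's differential-operator definition of the invariant
additive forms, read in the tensor square through Grothendieck duality (encloser-2's `mem_ideal_pow_iff_forall_dPair`).
[cite: Oda1983HironakaGroupSchemeII, §2 (p. 1168) and Cor. 2.3 (p. 1171)] -/
theorem mem_invForms_attP_iff (m : ℕ) (a : Fin (attN p e + 1) → RatField F 2) :
    a ∈ invForms (RatField F 2) p (attP F p e) (e + m) ↔
      attBeta m a ∈ KaehlerDifferential.ideal (frobPow (RatField F 2) p (e + m)) (RatField F 2) ^ p ^ (e + m) := by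
  have hq : p ^ (e + m) = (p ^ (e + m) - 1) + 1 := (Nat.sub_add_cancel (Nat.one_le_pow _ _ hp.out.pos)).symm
  have hpair : ∀ D : RatField F 2 →ₗ[frobPow (RatField F 2) p (e + m)] RatField F 2,
      dPair (frobPow (RatField F 2) p (e + m)) (AlgHom.id _ _) D (attBeta m a) =
        ∑ i, D (a i) * attC F p e i ^ p ^ m := by
    intro D
    unfold attBeta
    rw [map_sum]
    exact Finset.sum_congr rfl fun i _ => by rw [dPair_tmul, AlgHom.id_apply]
  have key := mem_ideal_pow_iff_forall_dPair (frobPow (RatField F 2) p (e + m)) (p ^ (e + m) - 1) (attBeta m a)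
  rw [← hq] at key
  rw [key]
  constructor
  · intro ha D hD
    rw [hpair, ← addForm_mem_attP_iff]
    exact ha D hD
  · intro h D hD
    show addForm (RatField F 2) p (e + m) (fun j => D (a j)) ∈ attP F p e
    rw [addForm_mem_attP_iff, ← hpair]
    exact h D hD

/-! ### Tower coordinates of `β_m(a)` -/

omit [CharP F p] in
/-- `c_i^{p^m} = u^{p^m W_i}`. [folklore] -/
theorem attC_pow (m : ℕ) (i : Fin (attN p e + 1)) :
    attC F p e i ^ p ^ m = ∏ l, ratGen F 2 l ^ (p ^ m • attW p e i) l := by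
  unfold attC
  rw [← Finset.prod_pow]
  exact Finset.prod_congr rfl fun l _ => by rw [← pow_mul, Finsupp.smul_apply, smul_eq_mul, mul_comm]

/-- `p^m W_i` lies in the box of side `p^{e+m}` (`ε_i ≤ 1 < p ≤ p^e`, `j_i ≤ q − 1`; needs `e ≥ 1`). [folklore] -/
theorem inBox_nsmul_attW (he : 1 ≤ e) (m : ℕ) (i : Fin (attN p e + 1)) :
    InBox (p ^ (e + m)) (p ^ m • attW p e i) := by
  have hpm : 0 < p ^ m := pow_pos hp.out.pos m
  have hW : ∀ l, attW p e i l < p ^ e := by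
    refine Fin.forall_fin_two.mpr ⟨?_, ?_⟩
    · rw [attW_zero]
      calc ((attIdx p e i).1 : ℕ) < 2 := ((attIdx p e i).1).2
        _ ≤ p := hp.out.two_le
        _ ≤ p ^ e := Nat.le_self_pow (by omega) p
    · rw [attW_one]; exact ((attIdx p e i).2).2
  intro l
  rw [Finsupp.smul_apply, smul_eq_mul, pow_add, mul_comm (p ^ e)]
  exact (Nat.mul_lt_mul_left hpm).mpr (hW l)

/-- **Tower coordinates of `β_m(a)`**: in the tower `k ⊃ k^{p^{e+m}}` with `p`-basis `u` the element
`Σ_i a_i ⊗ c_i^{p^m}` has left coordinates `Σ_i a_i (u + X)^{p^m W_i}` (no truncation occurs).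
[cite: Mizutani1973HironakaGroupSchemes, Remark 2.10 (in-house proof §1.2: 1 ⊗ a^W = (a ⊗ 1 − t)^W)] -/
theorem Omega_attBeta (hF : ∀ c : F, c ^ p = c) (he : 1 ≤ e) (m : ℕ) (a : Fin (attN p e + 1) → RatField F 2) :
    (isRootTower_ratField (s := 2) hF (e := e + m) (by omega)).Omega (attBeta m a) =
      ∑ i, C (a i) * pPlus (ratGen F 2) (p ^ m • attW p e i) := by
  set h := isRootTower_ratField (s := 2) hF (e := e + m) (by omega) with hh
  unfold attBeta
  rw [map_sum]
  refine Finset.sum_congr rfl fun i _ => ?_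
  rw [h.Omega_tmul, attC_pow, h.tau_prod_pow, truncQ_mk,
    trunc_eq_self fun M hM => inBox_of_mem_support_pPlus (inBox_nsmul_attW he m i) hM]

end Point

end Summit.ResolutionOfSingularities.KangarooAtlas.Mizutani
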